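import Summits.QuantumAdvantage.QuantumAdvantage.Theses.CubicForrelation
import Summits.QuantumAdvantage.QuantumAdvantage.Theorems.NearExactIsExact.Negative.SmallCasesWalsh

/-!
# Value witnesses for `NearExactIsExact` (stmt-QuantumAdvantage-14043): `Φ = 13/16` at `n = 8`, `Φ = 7/8` at `n = 10`

Negative-side support (certified-compute seat, 2026-08-16).  Two explicit NON-exact cubic pairs, evaluated exactly by the
Walsh checker of `SmallCasesWalsh.lean` (`forrelation_eq_fsumL` + `native_decide`):

* `n = 8`: the `𝔽₄`-pencil pair (the `r = 2` member of the family in `Cruxes/NearExactIsExact/Disproof.lean` §4):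
  `g(y′,u,w′,w″) = Tr(y′u) + Tr(u w′ w″)`, `f(a,b,c,d) = Tr(ab) + Tr(c d a²)` over `𝔽₄` in the self-dual basis `(ω, ω²)`;
  both cubic, `Φ(f,g) = 13/16` (`forrelation_f8_g8`) — the record value known at `n = 8`.
* `n = 10`: the `T`-family pair (route text; refuter 494f1478 on stmt-2202): `g = y′·T(y″)` with the quadratic permutation
  `T = (y₁, y₂, y₃, y₄ + y₁y₂, y₅ + y₃y₄)`, `f` = the cubic truncation of the quartic dual `x″·T⁻¹(x′)`; `Φ(f,g) = 7/8`
  (`forrelation_fT_gT`), so the conjectured threshold `7/8` of the crux is ATTAINED by a non-exact cubic pair at `n = 10`: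
  no `θ < 7/8` isolates exactness from `n = 10` on (`not_isolation_below_seven_eighths_ten`), complementing
  `nearExact78_le_six` (the threshold `7/8` works for all `n ≤ 6`).

`native_decide` evaluates the two forrelation sums (`fsumL`, fast Walsh–Hadamard transform): the file is `computational`.
References: Carlet 2021 §6.1 (Maiorana–McFarland bent functions and their duals); Aaronson–Ambainis 2018 §1.1.1.
-/

set_option linter.dupNamespace false -- D-0017: single-problem summit ⇒ `QuantumAdvantage.QuantumAdvantage` by design

namespace Summit.QuantumAdvantage.QuantumAdvantage.Theorems.NearExactIsExact.Negative.SmallCases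

open Finset
open Literature.Computability.QuantumComplexity
open Literature.Computability.QuantumComplexity.DerivativeWalsh (W fsum phi_eq_fsum fsum_eq_sum_mul_W)
open Literature.Computability.QuantumComplexity.BuzetChailloux (phi_signOf)
open Summit.QuantumAdvantage.QuantumAdvantage.Theorems.SignedExactSliceIsLift.StubMoebius (isDegLeFun_xor isDegLeFun_and)

/-! ### Exact evaluation of `Φ` by the checker -/

/-- The forrelation sum on codes: `Σ_y (−1)^{f(y)} W_g(y)`. [folklore] -/
def fsumZ (n : ℕ) (f g : (Fin n → Bool) → Bool) : ℤ := ∑ y ∈ range (2 ^ n), sgnZ (f (pt n y)) * wspec n g y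

/-- `Φ(f,g) · 2^{3m} = fsumZ f g` (`n = m + m`). [cite: AaronsonAmbainis2018, §1.1.1] -/
theorem forrelation_mul_eq_fsumZ (m : ℕ) (f g : (Fin (m + m) → Bool) → Bool) :
    forrelation f g * (2 : ℝ) ^ (3 * m) = (fsumZ (m + m) f g : ℝ) := by
  have hs : Real.sqrt ((2 : ℝ) ^ (3 * (m + m))) = (2 : ℝ) ^ (3 * m) := by
    rw [show (2 : ℝ) ^ (3 * (m + m)) = ((2 : ℝ) ^ (3 * m)) ^ 2 by ring, Real.sqrt_sq (by positivity)]
  have hpos : (0 : ℝ) < (2 : ℝ) ^ (3 * m) := by positivity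
  rw [← phi_signOf, phi_eq_fsum, fsum_eq_sum_mul_W, hs, inv_mul_eq_div, div_mul_cancel₀ _ hpos.ne', sum_pt, fsumZ]
  push_cast
  refine sum_congr rfl fun y _ => ?_
  rw [W_pt, signOf_eq_cast]

/-- The fast forrelation sum: signed table of `f` against the fast Walsh transform of the signed table of `g`. -/
def fsumL (n : ℕ) (f g : (Fin n → Bool) → Bool) : ℤ :=
  (List.zipWith (· * ·) (sigTable n f) (wal n (sigTable n g))).sum

/-- Sum of a `zipWith` of two integer lists of the same length as a sum over indices. [folklore] -/
theorem sum_zipWith_eq (l₁ l₂ : List ℤ) (h : l₁.length = l₂.length) :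
    (List.zipWith (· * ·) l₁ l₂).sum = ∑ i ∈ range l₁.length, (l₁[i]?.getD 0) * (l₂[i]?.getD 0) := by
  induction l₁ generalizing l₂ with
  | nil => simp
  | cons a l ih =>
    cases l₂ with
    | nil => simp at h
    | cons b l' =>
      rw [List.zipWith_cons_cons, List.sum_cons, List.length_cons, sum_range_succ', ih l' (by simpa using h)]
      simp [add_comm]

/-- The fast sum is the forrelation sum. [folklore] -/
theorem fsumL_eq (n : ℕ) (f g : (Fin n → Bool) → Bool) : fsumL n f g = fsumZ n f g := by
  have hl : (sigTable n f).length = 2 ^ n := by simp [sigTable]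
  rw [fsumL, sum_zipWith_eq _ _ (by rw [hl, length_wal _ _ (by simp [sigTable])]), hl, fsumZ]
  refine sum_congr rfl fun y hy => ?_
  rw [wal_sigTable n g y (mem_range.1 hy)]
  simp [sigTable, List.getElem?_range (mem_range.1 hy)]

/-- **Exact evaluation**: `Φ(f,g) = fsumL f g / 2^{3m}`. [cite: AaronsonAmbainis2018, §1.1.1] -/
theorem forrelation_eq_fsumL (m : ℕ) (f g : (Fin (m + m) → Bool) → Bool) :
    forrelation f g = (fsumL (m + m) f g : ℝ) / (2 : ℝ) ^ (3 * m) := by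
  rw [eq_div_iff (by positivity), forrelation_mul_eq_fsumZ, fsumL_eq]

/-! ### `n = 8`: the `𝔽₄`-pencil pair, `Φ = 13/16` -/

/-- `g(y′,u,w′,w″) = Tr(y′u) + Tr(u·w′·w″)` over `𝔽₄` (self-dual basis `(ω, ω²)`; coordinates `y′ = (y₀,y₁)`, `u = (y₂,y₃)`,
`w′ = (y₄,y₅)`, `w″ = (y₆,y₇)`). [cite: Carlet2020, §6.1] -/
def g8 (y : Fin (4 + 4) → Bool) : Bool :=
  xor (xor (y 0 && y 2) (y 1 && y 3))
    (xor ((xor (xor (y 2 && y 5) (y 3 && y 4)) (y 3 && y 5)) && y 6) ((xor (xor (y 2 && y 4) (y 2 && y 5)) (y 3 && y 4)) && y 7))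

/-- `f(a,b,c,d) = Tr(ab) + Tr(c·d·a²)` over `𝔽₄` (same coordinates). [cite: Carlet2020, §6.1] -/
def f8 (x : Fin (4 + 4) → Bool) : Bool :=
  xor (xor (x 0 && x 2) (x 1 && x 3))
    (xor ((xor (xor (x 4 && x 7) (x 5 && x 6)) (x 5 && x 7)) && x 1) ((xor (xor (x 4 && x 6) (x 4 && x 7)) (x 5 && x 6)) && x 0))

/-- `g8` is cubic. [cite: Carlet2020, §2.2.1 Def. 6] -/
theorem isDegLeFun_g8 : IsDegLeFun 3 g8 := by
  unfold g8
  repeat (first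
    | exact isDegLeFun_apply _ (by norm_num)
    | exact (isDegLeFun_and (a := 1) (b := 1) (isDegLeFun_apply _ le_rfl) (isDegLeFun_apply _ le_rfl)).mono (by norm_num)
    | apply isDegLeFun_xor
    | refine (isDegLeFun_and (a := 2) (b := 1) ?_ (isDegLeFun_apply _ le_rfl)).mono (by norm_num))

/-- `f8` is cubic. [cite: Carlet2020, §2.2.1 Def. 6] -/
theorem isDegLeFun_f8 : IsDegLeFun 3 f8 := by
  unfold f8
  repeat (first
    | exact isDegLeFun_apply _ (by norm_num)
    | exact (isDegLeFun_and (a := 1) (b := 1) (isDegLeFun_apply _ le_rfl) (isDegLeFun_apply _ le_rfl)).mono (by norm_num)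
    | apply isDegLeFun_xor
    | refine (isDegLeFun_and (a := 2) (b := 1) ?_ (isDegLeFun_apply _ le_rfl)).mono (by norm_num))

/-- The forrelation sum of the `𝔽₄` pair: `13/16 · 2¹² = 3328`. [folklore] -/
theorem fsumL_f8_g8 : fsumL (4 + 4) f8 g8 = 3328 := by native_decide

/-- **`Φ(f8, g8) = 13/16`** — a non-exact cubic pair on `8` bits. [folklore] -/
theorem forrelation_f8_g8 : forrelation f8 g8 = 13 / 16 := by
  rw [forrelation_eq_fsumL 4 f8 g8, fsumL_f8_g8]; norm_num

/-! ### `n = 10`: the `T`-family pair, `Φ = 7/8` -/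

/-- `gT = y′·T(y″)`, `T = (y₅, y₆, y₇, y₈ + y₅y₆, y₉ + y₇y₈)` (`y′ = (y₀,…,y₄)`, `y″ = (y₅,…,y₉)`): a cubic Maiorana–McFarland
bent function whose dual `x″·T⁻¹(x′)` has degree `4`. [cite: Carlet2020, §6.1] -/
def gT (y : Fin (5 + 5) → Bool) : Bool :=
  xor (xor (xor (xor (y 0 && y 5) (y 1 && y 6)) (y 2 && y 7)) (y 3 && xor (y 8) (y 5 && y 6))) (y 4 && xor (y 9) (y 7 && y 8))

/-- `fT` = the cubic truncation of the dual of `gT`: `x″·T⁻¹(x′)` minus the quartic monomial `x₉x₀x₁x₂`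
(`T⁻¹(z) = (z₀, z₁, z₂, z₃ + z₀z₁, z₄ + z₂z₃ + z₀z₁z₂)`). [cite: Carlet2020, §6.1] -/
def fT (x : Fin (5 + 5) → Bool) : Bool :=
  xor (xor (xor (xor (x 5 && x 0) (x 6 && x 1)) (x 7 && x 2)) (x 8 && xor (x 3) (x 0 && x 1))) (x 9 && xor (x 4) (x 2 && x 3))

/-- `gT` is cubic. [cite: Carlet2020, §2.2.1 Def. 6] -/
theorem isDegLeFun_gT : IsDegLeFun 3 gT := by
  unfold gT
  repeat (first
    | exact isDegLeFun_apply _ (by norm_num)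
    | exact (isDegLeFun_and (a := 1) (b := 1) (isDegLeFun_apply _ le_rfl) (isDegLeFun_apply _ le_rfl)).mono (by norm_num)
    | apply isDegLeFun_xor
    | refine (isDegLeFun_and (a := 1) (b := 2) (isDegLeFun_apply _ le_rfl) ?_).mono (by norm_num))

/-- `fT` is cubic. [cite: Carlet2020, §2.2.1 Def. 6] -/
theorem isDegLeFun_fT : IsDegLeFun 3 fT := by
  unfold fT
  repeat (first
    | exact isDegLeFun_apply _ (by norm_num)
    | exact (isDegLeFun_and (a := 1) (b := 1) (isDegLeFun_apply _ le_rfl) (isDegLeFun_apply _ le_rfl)).mono (by norm_num)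
    | apply isDegLeFun_xor
    | refine (isDegLeFun_and (a := 1) (b := 2) (isDegLeFun_apply _ le_rfl) ?_).mono (by norm_num))

/-- The forrelation sum of the `T`-family pair: `7/8 · 2¹⁵ = 28672`. [folklore] -/
theorem fsumL_fT_gT : fsumL (5 + 5) fT gT = 28672 := by native_decide

/-- **`Φ(fT, gT) = 7/8`** — the conjectured sharp constant of the crux is attained by a non-exact cubic pair at `n = 10`.
[folklore] -/
theorem forrelation_fT_gT : forrelation fT gT = 7 / 8 := by
  rw [forrelation_eq_fsumL 5 fT gT, fsumL_fT_gT]; norm_num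

/-! ### Consequences: lower bounds for the isolating threshold -/

/-- **A non-exact cubic pair with `Φ = 13/16` on `8` bits.** [folklore] -/
theorem exists_cubic_pair_eight :
    ∃ f g : (Fin (4 + 4) → Bool) → Bool, IsDegLeFun 3 f ∧ IsDegLeFun 3 g ∧ forrelation f g = 13 / 16 :=
  ⟨f8, g8, isDegLeFun_f8, isDegLeFun_g8, forrelation_f8_g8⟩

/-- **A non-exact cubic pair with `Φ = 7/8` on `10` bits.** [folklore] -/
theorem exists_cubic_pair_ten :
    ∃ f g : (Fin (5 + 5) → Bool) → Bool, IsDegLeFun 3 f ∧ IsDegLeFun 3 g ∧ forrelation f g = 7 / 8 :=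
  ⟨fT, gT, isDegLeFun_fT, isDegLeFun_gT, forrelation_fT_gT⟩

/-- **No threshold below `7/8` isolates exactness at `n = 10`**: for `θ < 7/8` the clause of `NearExactIsExact` fails already
on `10` bits (witness `(fT, gT)`).  Together with `nearExact78_le_six` (`7/8` isolates for every even `n ≤ 6`) and
`not_nearExact_at_of_lt` (`15/16` needed from `n = 16`), this pins the small-`n` profile of the isolating threshold. [folklore] -/
theorem not_isolation_below_seven_eighths_ten {θ : ℝ} (hθ : θ < 7 / 8) :
    ¬ (∀ f g : (Fin (5 + 5) → Bool) → Bool, IsDegLeFun 3 f → IsDegLeFun 3 g →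
        θ < forrelation f g → forrelation f g = 1) := by
  intro h
  have h1 := h fT gT isDegLeFun_fT isDegLeFun_gT (by rw [forrelation_fT_gT]; exact hθ)
  rw [forrelation_fT_gT] at h1
  norm_num at h1

/-- **No threshold below `13/16` isolates exactness at `n = 8`** (witness `(f8, g8)`). [folklore] -/
theorem not_isolation_below_thirteen_sixteenths_eight {θ : ℝ} (hθ : θ < 13 / 16) :
    ¬ (∀ f g : (Fin (4 + 4) → Bool) → Bool, IsDegLeFun 3 f → IsDegLeFun 3 g →
        θ < forrelation f g → forrelation f g = 1) := by
  intro h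
  have h1 := h f8 g8 isDegLeFun_f8 isDegLeFun_g8 (by rw [forrelation_f8_g8]; exact hθ)
  rw [forrelation_f8_g8] at h1
  norm_num at h1

open Summit.QuantumAdvantage.QuantumAdvantage.Theses.CubicForrelation (NearExactIsExact) in
/-- **Every threshold witnessing the crux is `≥ 7/8`** (by the `n = 10` pair; the landed `15/16` witness at `n = 16`
sharpens this, in a file outside this import closure): `NearExactIsExact` holds iff it holds with some `θ ∈ [7/8, 1)`.
[folklore] -/
theorem nearExactIsExact_iff_ge_seven_eighths :
    NearExactIsExact ↔ ∃ θ : ℝ, 7 / 8 ≤ θ ∧ θ < 1 ∧ ∀ n : ℕ, Even n → ∀ f g : (Fin n → Bool) → Bool,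
      IsDegLeFun 3 f → IsDegLeFun 3 g → θ < forrelation f g → forrelation f g = 1 := by
  constructor
  · rintro ⟨θ, hθ1, h⟩
    refine ⟨θ, ?_, hθ1, h⟩
    by_contra hlt
    exact not_isolation_below_seven_eighths_ten (lt_of_not_ge hlt) (fun f g hf hg hθ => h (5 + 5) ⟨5, rfl⟩ f g hf hg hθ)
  · rintro ⟨θ, -, hθ1, h⟩
    exact ⟨θ, hθ1, h⟩

end Summit.QuantumAdvantage.QuantumAdvantage.Theorems.NearExactIsExact.Negative.SmallCases
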